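import Literature.NumberTheory.Automorphic.AlgebraicWeightContinuousPointOfFiniteness
import Literature.NumberTheory.Automorphic.TwistedQuotientIndFunDirectedUnion
import Literature.NumberTheory.Automorphic.ArithmeticQuotientCohomologyFiniteProofs
import Literature.Algebra.Homology.GroupCohomologyIntResolutionFiniteType
import HarnessLib

/-!
# `algebraicWeightEigenclass_continuousPoint` from "`GL_n(𝓞_K)` is virtually of type (FL)"

Topic `NumberTheory/Automorphic`; namespace `Literature.NumberTheory.Automorphic.AlgebraicWeight`.
Theorems only; no named fact, no instance, no `sorry`.

`AlgebraicWeightContinuousPointOfFiniteness` reduces the named fact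
`algebraicWeightEigenclass_continuousPoint` ([Scholze2015, Thm. V.4.1 / Cor. V.4.2] for the
completed-cohomology Hecke algebra of the tree) to the two finiteness inputs `HX`, `HU` of the
printed proof ("`X_K` is homotopy equivalent to a finite CW complex"), and
`algebraicWeightEigenclass_continuousPoint_of_FP` derives them from finite-type free resolutions of
ALL arithmetic subgroups of `GL_n(K)` over ALL rings.  Here the residual hypothesis is brought to
the form in which the finiteness theorem of Borel–Serre is PRINTED and in which the other
Borel–Serre consumers of the tree take it
(`BorelSerre1973_finite_groupCohomology_congruenceSubgroup_of_glIntegers`,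
`…_of_typeFL_torsionFree` of `ArithmeticQuotientCohomologyFiniteProofs`):

* `algebraicWeightEigenclass_continuousPoint_of_glIntegers` — from: for every `n` and every
  number field `K`, `GL_n(𝓞_K)` (Mathlib `GL (Fin n) (𝓞 K)`) has a subgroup `Γ'` of finite index
  such that the trivial `ℤ[Γ']`-module `ℤ` has a projective resolution by free `ℤ[Γ']`-modules of
  finite rank ([BorelSerre1973, Thm. 11.4.4 with §11.1 (c) and 11.6]: `GL_n(𝓞_K)`, an arithmetic
  subgroup of `R_{K/ℚ} GL_n`, is of type (WFL), in particular (VFL));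
* `algebraicWeightEigenclass_continuousPoint_of_typeFL_torsionFree` — from [BorelSerre1973,
  §11.1 (c)] AS PRINTED: every torsion-free subgroup of finite index of `GL_n(𝓞_K)` is of type
  (FL) (the existence of such a subgroup — Minkowski — is the tree's
  `NumberFields.GeneralLinearGroup.exists_finiteIndex_forall_isOfFinOrder_eq_one`).

Chain (per orbit stabiliser `Γ_x = GL_n(K) ∩ x U x⁻¹`, commensurable with the image of
`GL_n(𝓞_K)`, `commensurable_orbitStabilizer_glIntegers`): type `FP_∞` over `ℤ` for `Γ'` gives
cohomology of finite type over `ℤ_p` with multiplier `1`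
(`isCohFiniteTypeUpTo_one_of_int_resolution`: restriction of scalars, no base change of
resolutions), which ascends to `GL_n(𝓞_K)` with multiplier `[GL_n(𝓞_K) : Γ']` (transfer),
transports to the image in `GL_n(K)` and passes to the commensurable `Γ_x`
(`IsCohFiniteTypeUpTo.of_subgroup`, `.of_mulEquiv`, `.of_commensurable` of
`GroupCohomologyFiniteType`) — `exists_isCohFiniteTypeUpTo_of_glIntegers`.  Its (F)-part is `HX`
orbit by orbit (`moduleFinite_cohomology_indFun_stageLattice_of_glIntegers`); its (U)-part, glued
over the finitely many orbits with the product of the multipliers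
(`exists_map_indFunMap_eq_prod_nsmul_of_orbits`), gives every class `y` of `H^q(Γ, indFun V)` a
multiple `N • y`, `N ≥ 1`, coming from a stage `H^q(Γ, indFun p^{-t} M_S)`; writing
`N = p^a u` with `p ∤ u`, `u ∈ ℤ_p^×`, this is `HU` with the `p`-power `p^{t+a}`
(`exists_stage_of_glIntegers`).

## References

* P. Scholze, *On torsion in the cohomology of locally symmetric varieties*, Ann. of Math. 182
  (2015), §V.4, Thm. V.4.1, Cor. V.4.2. [Scholze2015]
* A. Borel, J.-P. Serre, *Corners and arithmetic groups*, Comment. Math. Helv. 48 (1973),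
  §11.1 (c), Thm. 11.4.4, 11.6. [BorelSerre1973]
* J.-P. Serre, *Cohomologie des groupes discrets* (1971), §1.8, §2.4 Th. 4.
  [Serre1971CohomologieGroupesDiscrets]
* K. S. Brown, *Cohomology of Groups*, GTM 87 (1982), III (6.2), (9.5), VIII (4.6), (5.1).
  [Brown1982CohomologyGroups]
-/

noncomputable section

open CategoryTheory
open IsDedekindDomain NumberField
open Literature.Algebra.Homology
open Literature.NumberTheory.Automorphic.BigHeckeGLn Literature.NumberTheory.Automorphic.TwistedQuotient

namespace Literature.NumberTheory.Automorphic

namespace AlgebraicWeight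

/-! ### Cohomology of finite type for the arithmetic subgroups of `GL_n(K)` -/

/-- **Every subgroup of `GL_n(K)` commensurable with the image of `GL_n(𝓞_K)` has cohomology of
finite type over `k`, up to a positive multiplier**, granted a subgroup `Γ'` of finite index of
`GL_n(𝓞_K)` of type `FP_∞` over `ℤ` (resolution `P`): `Γ'` has it with multiplier `1` over `k`,
`GL_n(𝓞_K)` with multiplier `[GL_n(𝓞_K) : Γ']`, hence its isomorphic image in `GL_n(K)`, hence
the commensurable `Γ_x`. [cite: BorelSerre1973, §11.1 (c), Thm. 11.4.4]
[cite: Brown1982CohomologyGroups, VIII (5.1), III (9.5)] -/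
theorem exists_isCohFiniteTypeUpTo_of_glIntegers (K : Type) [Field K] [NumberField K] (n : ℕ)
    (k : Type) [CommRing k] (Γ' : Subgroup (GL (Fin n) (𝓞 K))) [Γ'.FiniteIndex]
    (P : ProjectiveResolution (Rep.trivial ℤ Γ' ℤ))
    (hP : ∀ i, ∃ m : ℕ, Nonempty (P.complex.X i ≅ Rep.free ℤ Γ' (Fin m)))
    (Γx : Subgroup (GL (Fin n) K))
    (hc : Γx.Commensurable (Matrix.GeneralLinearGroup.map (algebraMap (𝓞 K) K) :
      GL (Fin n) (𝓞 K) →* GL (Fin n) K).range) :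
    ∃ m : ℕ, 0 < m ∧ IsCohFiniteTypeUpTo k Γx m := by
  -- `Γ'`, then `GL_n(𝓞_K)` by ascent
  have h₁ : IsCohFiniteTypeUpTo k Γ' 1 := isCohFiniteTypeUpTo_one_of_int_resolution P hP
  have h₂ : IsCohFiniteTypeUpTo k (GL (Fin n) (𝓞 K)) (1 * Γ'.index) :=
    IsCohFiniteTypeUpTo.of_subgroup (S := Γ') h₁
  -- the image in `GL_n(K)`
  have h₃ : IsCohFiniteTypeUpTo k (Matrix.GeneralLinearGroup.map (algebraMap (𝓞 K) K) :
      GL (Fin n) (𝓞 K) →* GL (Fin n) K).range (1 * Γ'.index) :=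
    IsCohFiniteTypeUpTo.of_mulEquiv
      (MonoidHom.ofInjective (map_algebraMap_ringOfIntegers_injective n K)) h₂
  -- the commensurable `Γx`
  haveI : (Γx.subgroupOf (Matrix.GeneralLinearGroup.map (algebraMap (𝓞 K) K) :
      GL (Fin n) (𝓞 K) →* GL (Fin n) K).range).FiniteIndex := ⟨hc.1⟩
  haveI : ((Matrix.GeneralLinearGroup.map (algebraMap (𝓞 K) K) :
      GL (Fin n) (𝓞 K) →* GL (Fin n) K).range.subgroupOf Γx).FiniteIndex := ⟨hc.2⟩
  refine ⟨1 * Γ'.index * ((Matrix.GeneralLinearGroup.map (algebraMap (𝓞 K) K) :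
      GL (Fin n) (𝓞 K) →* GL (Fin n) K).range.subgroupOf Γx).index, ?_,
    IsCohFiniteTypeUpTo.of_commensurable (Γ := Γx) (h₀ := h₃)⟩
  rw [one_mul]
  exact Nat.mul_pos (Nat.pos_of_ne_zero Subgroup.FiniteIndex.index_ne_zero)
    (Nat.pos_of_ne_zero Subgroup.FiniteIndex.index_ne_zero)

variable (K : Type) [Field K] [NumberField K] (n p : ℕ) [Fact p.Prime]
  (lam : (K →+* PadicAlgCl p) → Fin n → ℤ)

/-- **The orbit stabilisers `Γ_x` have cohomology of finite type over `ℤ_p` up to a positive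
multiplier**, granted "`GL_n(𝓞_K)` is virtually of type (FL)".
[cite: BorelSerre1973, §11.1 (c), Thm. 11.4.4] -/
theorem exists_isCohFiniteTypeUpTo_orbitStabilizer
    (h : ∀ (n : ℕ) (K : Type) [Field K] [NumberField K],
      ∃ Γ' : Subgroup (GL (Fin n) (𝓞 K)), Γ'.FiniteIndex ∧
        ∃ P : ProjectiveResolution (Rep.trivial ℤ Γ' ℤ),
          ∀ i, ∃ m : ℕ, Nonempty (P.complex.X i ≅ Rep.free ℤ Γ' (Fin m)))
    (𝒰 : TameLevel n K p) (x : FiniteAdelicGL n K) :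
    ∃ m : ℕ, 0 < m ∧ IsCohFiniteTypeUpTo ℤ_[p]
      (orbitStabilizer (globalEmbedding n K) 𝒰.subgroup (x : FiniteAdelicGL n K ⧸ 𝒰.subgroup)) m := by
  obtain ⟨Γ', hΓ', P, hP⟩ := h n K
  haveI := hΓ'
  exact exists_isCohFiniteTypeUpTo_of_glIntegers K n ℤ_[p] Γ' P hP _
    (commensurable_orbitStabilizer_glIntegers 𝒰.subgroup 𝒰.isOpen 𝒰.isCompact _)

/-! ### HX -/

/-- **`H^q(Γ, indFun M_S)` is a finitely generated `ℤ_p`-module, granted "`GL_n(𝓞_K)` is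
virtually of type (FL)".** [cite: Scholze2015, §V.4 (proof of Thm. V.4.1)]
[cite: BorelSerre1973, §11.1 (c), Thm. 11.4.4] -/
theorem moduleFinite_cohomology_indFun_stageLattice_of_glIntegers
    (h : ∀ (n : ℕ) (K : Type) [Field K] [NumberField K],
      ∃ Γ' : Subgroup (GL (Fin n) (𝓞 K)), Γ'.FiniteIndex ∧
        ∃ P : ProjectiveResolution (Rep.trivial ℤ Γ' ℤ),
          ∀ i, ∃ m : ℕ, Nonempty (P.complex.X i ≅ Rep.free ℤ Γ' (Fin m)))
    (𝒰 : TameLevel n K p) {S : Finset (PadicAlgCl p)} (hS : ∀ c ∈ S, ‖c‖ ≤ 1) (q : ℕ) :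
    Module.Finite ℤ_[p] (groupCohomology (indFun (globalEmbedding n K) 𝒰.subgroup
      (latticeRep 𝒰.subgroup (padicIntRep K n p lam) (stageLattice K n p lam S)
        (stageLattice_stable K n p lam 𝒰 S))) q) := by
  obtain ⟨s, -, hcov⟩ := exists_orbit_representatives K n p 𝒰
  refine moduleFinite_cohomology_indFun_of_finite_cover (globalEmbedding n K) 𝒰.subgroup _ s hcov q
    fun x _ => ?_
  haveI : Module.Finite ℤ_[p] (indStabilizerRep (globalEmbedding n K) 𝒰.subgroup
      (latticeRep 𝒰.subgroup (padicIntRep K n p lam) (stageLattice K n p lam S)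
        (stageLattice_stable K n p lam 𝒰 S)) x) :=
    moduleFinite_stageLattice K n p lam hS
  obtain ⟨m, -, hft⟩ := exists_isCohFiniteTypeUpTo_orbitStabilizer K n p h 𝒰 x
  exact hft.moduleFinite _ q

/-! ### HU -/

/-- The directed system of the stage lattices `p^{-t} M_S ↪ V`, seen by one orbit stabiliser
`Γ_x` (a `DirectedSubrepSystem`). [folklore] -/
theorem exists_map_indStabMap_eq_nsmul_of_glIntegers
    (h : ∀ (n : ℕ) (K : Type) [Field K] [NumberField K],
      ∃ Γ' : Subgroup (GL (Fin n) (𝓞 K)), Γ'.FiniteIndex ∧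
        ∃ P : ProjectiveResolution (Rep.trivial ℤ Γ' ℤ),
          ∀ i, ∃ m : ℕ, Nonempty (P.complex.X i ≅ Rep.free ℤ Γ' (Fin m)))
    (𝒰 : TameLevel n K p) (x : FiniteAdelicGL n K) (q : ℕ) :
    ∃ m : ℕ, 0 < m ∧ ∀ z : groupCohomology (indStabilizerRep (globalEmbedding n K) 𝒰.subgroup
      (latticeRep 𝒰.subgroup (padicIntRep K n p lam) ⊤ (top_stable' K n p lam 𝒰.subgroup)) x) q,
      ∃ (i : StageIndex p) (y : groupCohomology (indStabilizerRep (globalEmbedding n K) 𝒰.subgroup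
        (stageDivRep K n p lam 𝒰 i) x) q),
        groupCohomology.map (MonoidHom.id _) (indStabMap (globalEmbedding n K) 𝒰.subgroup
          (stageDivRep K n p lam 𝒰 i) _ x (stageDivIncl K n p lam 𝒰 i)) q y = m • z := by
  haveI : IsDirected (StageIndex p) (· ≤ ·) := stageIndex_isDirected p
  haveI : Nonempty (StageIndex p) := ⟨(⟨∅, fun c hc => absurd hc (Finset.notMem_empty c)⟩, 0)⟩
  obtain ⟨m, hm, hft⟩ := exists_isCohFiniteTypeUpTo_orbitStabilizer K n p h 𝒰 x
  -- the system seen by `Γ_x`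
  let D : DirectedSubrepSystem ℤ_[p]
      (orbitStabilizer (globalEmbedding n K) 𝒰.subgroup (x : FiniteAdelicGL n K ⧸ 𝒰.subgroup)) :=
    { ι := StageIndex p
      A := fun i => indStabilizerRep (globalEmbedding n K) 𝒰.subgroup (stageDivRep K n p lam 𝒰 i) x
      B := indStabilizerRep (globalEmbedding n K) 𝒰.subgroup
        (latticeRep 𝒰.subgroup (padicIntRep K n p lam) ⊤ (top_stable' K n p lam 𝒰.subgroup)) x
      φ := fun i => indStabMap (globalEmbedding n K) 𝒰.subgroup (stageDivRep K n p lam 𝒰 i) _ x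
        (stageDivIncl K n p lam 𝒰 i)
      injective := fun i => indStabMap_injective (globalEmbedding n K) 𝒰.subgroup
        (stageDivRep K n p lam 𝒰 i) _ x (stageDivIncl K n p lam 𝒰 i)
        (stageDivIncl_injective K n p lam 𝒰 i)
      t := fun _ _ hij => indStabMap (globalEmbedding n K) 𝒰.subgroup (stageDivRep K n p lam 𝒰 _)
        (stageDivRep K n p lam 𝒰 _) x (stageDivTrans K n p lam 𝒰 hij)
      t_comp := fun _ _ hij => Rep.hom_ext (Representation.IntertwiningMap.ext (LinearMap.ext
        fun v => stageDivIncl_stageDivTrans K n p lam 𝒰 hij v))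
      exhaust := fun v => by
        obtain ⟨i, w, hw⟩ := stageDiv_cover K n p lam 𝒰 v
        exact ⟨i, w, hw⟩ }
  exact ⟨m, hm, fun z => hft.exists_map_eq D q z⟩

/-- **Every class of `H^q(Γ, indFun V)` has a positive integer multiple coming from some stage
`H^q(Γ, indFun p^{-t} M_S)`, granted "`GL_n(𝓞_K)` is virtually of type (FL)"** (the multiple is
the product over the orbits of the multipliers of the stabilisers).
[cite: Scholze2015, §V.4 (proof of Thm. V.4.1)] [cite: Brown1982CohomologyGroups, VIII (4.6), III (9.5)] -/
theorem exists_stageDiv_nsmul_of_glIntegers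
    (h : ∀ (n : ℕ) (K : Type) [Field K] [NumberField K],
      ∃ Γ' : Subgroup (GL (Fin n) (𝓞 K)), Γ'.FiniteIndex ∧
        ∃ P : ProjectiveResolution (Rep.trivial ℤ Γ' ℤ),
          ∀ i, ∃ m : ℕ, Nonempty (P.complex.X i ≅ Rep.free ℤ Γ' (Fin m)))
    (𝒰 : TameLevel n K p) (q : ℕ) :
    ∃ N : ℕ, 0 < N ∧ ∀ y : groupCohomology (indFun (globalEmbedding n K) 𝒰.subgroup
      (latticeRep 𝒰.subgroup (padicIntRep K n p lam) ⊤ (top_stable' K n p lam 𝒰.subgroup))) q,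
      ∃ (i : StageIndex p) (y' : groupCohomology (indFun (globalEmbedding n K) 𝒰.subgroup
        (stageDivRep K n p lam 𝒰 i)) q),
        groupCohomology.map (MonoidHom.id _) (indFunMap (globalEmbedding n K) 𝒰.subgroup
          (stageDivRep K n p lam 𝒰 i) _ (stageDivIncl K n p lam 𝒰 i)) q y' = N • y := by
  haveI : IsDirected (StageIndex p) (· ≤ ·) := stageIndex_isDirected p
  haveI : Nonempty (StageIndex p) := ⟨(⟨∅, fun c hc => absurd hc (Finset.notMem_empty c)⟩, 0)⟩
  obtain ⟨s, hdisj, hcov⟩ := exists_orbit_representatives K n p 𝒰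
  choose m hm0 hm using fun x : FiniteAdelicGL n K =>
    exists_map_indStabMap_eq_nsmul_of_glIntegers K n p lam h 𝒰 x q
  refine ⟨∏ x ∈ s, m x, Finset.prod_pos fun x _ => hm0 x, fun y => ?_⟩
  exact exists_map_indFunMap_eq_prod_nsmul_of_orbits (globalEmbedding n K) 𝒰.subgroup
    (latticeRep 𝒰.subgroup (padicIntRep K n p lam) ⊤ (top_stable' K n p lam 𝒰.subgroup))
    (stageDivRep K n p lam 𝒰) (stageDivIncl K n p lam 𝒰) (stageDivTrans K n p lam 𝒰)
    (stageDivIncl_stageDivTrans K n p lam 𝒰) s hdisj hcov m q (fun x _ z => hm x z) y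

/-- **Every class of `H^q(Γ, indFun V)` has a `p`-power multiple in the image of some
`H^q(Γ, indFun M_S)`, granted "`GL_n(𝓞_K)` is virtually of type (FL)"** — the hypothesis `HU` of
`algebraicWeightEigenclass_continuousPoint_of_finiteness`: the positive multiple `N = p^a u`,
`p ∤ u`, of `exists_stageDiv_nsmul_of_glIntegers` is corrected by the unit `u⁻¹ ∈ ℤ_p^×`, and
`p^{-t} M_S ≅ M_S` by `p^t`. [cite: Scholze2015, §V.4 (proof of Thm. V.4.1)] -/
theorem exists_stage_of_glIntegers
    (h : ∀ (n : ℕ) (K : Type) [Field K] [NumberField K],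
      ∃ Γ' : Subgroup (GL (Fin n) (𝓞 K)), Γ'.FiniteIndex ∧
        ∃ P : ProjectiveResolution (Rep.trivial ℤ Γ' ℤ),
          ∀ i, ∃ m : ℕ, Nonempty (P.complex.X i ≅ Rep.free ℤ Γ' (Fin m)))
    (𝒰 : TameLevel n K p) (q : ℕ)
    (y : groupCohomology (indFun (globalEmbedding n K) 𝒰.subgroup
      (latticeRep 𝒰.subgroup (padicIntRep K n p lam) ⊤ (top_stable' K n p lam 𝒰.subgroup))) q) :
    ∃ S : Finset (PadicAlgCl p), (∀ c ∈ S, ‖c‖ ≤ 1) ∧ ∃ (c : ℕ)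
      (z : groupCohomology (indFun (globalEmbedding n K) 𝒰.subgroup
        (latticeRep 𝒰.subgroup (padicIntRep K n p lam) (stageLattice K n p lam S)
          (stageLattice_stable K n p lam 𝒰 S))) q),
      ((groupCohomology.functor ℤ_[p] (GL (Fin n) K) q).map
        (indInclTop K n p lam 𝒰.subgroup (stageLattice K n p lam S)
          (stageLattice_stable K n p lam 𝒰 S))).hom z = (((p ^ c : ℕ) : ℤ_[p])) • y := by
  have hp : p.Prime := Fact.out
  obtain ⟨N, hN, hU⟩ := exists_stageDiv_nsmul_of_glIntegers K n p lam h 𝒰 q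
  obtain ⟨i, y', hy'⟩ := hU y
  -- `N = p^a u` with `p ∤ u`, and `u` is a unit of `ℤ_p`
  obtain ⟨a, u, hu, hNeq⟩ := Nat.exists_eq_pow_mul_and_not_dvd hN.ne' p hp.one_lt.ne'
  have hunit : IsUnit (u : ℤ_[p]) := by
    rw [PadicInt.isUnit_iff]
    exact le_antisymm (PadicInt.norm_le_one _)
      (not_lt.1 fun hlt => hu (PadicInt.norm_natCast_lt_one_iff.1 hlt))
  obtain ⟨uu, huu⟩ := hunit
  -- rescale the preimage by `u⁻¹`
  have hy'' : groupCohomology.map (MonoidHom.id _) (indFunMap (globalEmbedding n K) 𝒰.subgroup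
      (stageDivRep K n p lam 𝒰 i) _ (stageDivIncl K n p lam 𝒰 i)) q ((↑uu⁻¹ : ℤ_[p]) • y') =
        (((p ^ a : ℕ) : ℤ_[p])) • y := by
    rw [map_smul, hy', ← Nat.cast_smul_eq_nsmul ℤ_[p], hNeq, Nat.cast_mul, ← huu, smul_smul,
      mul_comm (((p ^ a : ℕ) : ℤ_[p])), ← mul_assoc, Units.inv_mul, one_mul]
  -- `p^{-t} M_S ≅ M_S` by `p^t`
  obtain ⟨z, hz⟩ := exists_of_map_indFunMap_divLattice (globalEmbedding n K) 𝒰.subgroup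
    (padicIntRep K n p lam) (stageLattice K n p lam i.1.1) (stageLattice_stable K n p lam 𝒰 i.1.1)
    (p ^ i.2) (top_stable' K n p lam 𝒰.subgroup) le_top le_top q _ _ hy''
  refine ⟨i.1.1, i.1.2, i.2 + a, z, ?_⟩
  rw [pow_add, Nat.cast_mul, mul_smul, Nat.cast_smul_eq_nsmul ℤ_[p] (p ^ i.2)]
  exact hz

/-! ### The named fact from "`GL_n(𝓞_K)` is virtually of type (FL)" -/

/-- **`algebraicWeightEigenclass_continuousPoint` from "`GL_n(𝓞_K)` is virtually of type
(FL)"**: if for every `n` and every number field `K` the arithmetic group `GL_n(𝓞_K)` (Mathlib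
`GL (Fin n) (𝓞 K)`) has a subgroup `Γ'` of finite index such that the trivial `ℤ[Γ']`-module `ℤ`
admits a projective resolution by free `ℤ[Γ']`-modules of finite rank — [BorelSerre1973,
Thm. 11.4.4 with §11.1 (c) and 11.6] for the arithmetic subgroup `GL_n(𝓞_K)` of `R_{K/ℚ} GL_n`
("of type (WFL)", in particular (VFL), [Serre1971CohomologieGroupesDiscrets, §2.4 Th. 4 (a),
§1.8]) — then [Scholze2015, Thm. V.4.1 / Cor. V.4.2] in the tree's form holds.  Same hypothesis,
verbatim, as `BorelSerre1973_finite_groupCohomology_congruenceSubgroup_of_glIntegers`.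
[cite: Scholze2015, Thm. V.4.1 and Cor. V.4.2] [cite: BorelSerre1973, §11.1 (c), Thm. 11.4.4, 11.6] -/
theorem algebraicWeightEigenclass_continuousPoint_of_glIntegers
    (h : ∀ (n : ℕ) (K : Type) [Field K] [NumberField K],
      ∃ Γ' : Subgroup (GL (Fin n) (𝓞 K)), Γ'.FiniteIndex ∧
        ∃ P : ProjectiveResolution (Rep.trivial ℤ Γ' ℤ),
          ∀ i, ∃ m : ℕ, Nonempty (P.complex.X i ≅ Rep.free ℤ Γ' (Fin m))) :
    algebraicWeightEigenclass_continuousPoint :=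
  algebraicWeightEigenclass_continuousPoint_of_finiteness
    (fun K _ _ n p _ lam 𝒰 _ hS q =>
      moduleFinite_cohomology_indFun_stageLattice_of_glIntegers K n p lam h 𝒰 hS q)
    (fun K _ _ n p _ lam 𝒰 q y => exists_stage_of_glIntegers K n p lam h 𝒰 q y)

/-- **`algebraicWeightEigenclass_continuousPoint` from [BorelSerre1973, §11.1 (c)] as printed:
"torsion-free arithmetic groups are of type (FL)"** — if for every `n`, every number field `K`
and every TORSION-FREE subgroup `Γ'` of finite index of `GL_n(𝓞_K)` the trivial `ℤ[Γ']`-module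
`ℤ` admits a projective resolution by free `ℤ[Γ']`-modules of finite rank ("a triangulation of
`X̄/Γ` lifts to a `Γ`-invariant triangulation of `X̄` and the corresponding complex of simplicial
chains gives a `ℤ[Γ]`-free resolution of finite type of the `ℤ[Γ]`-module `ℤ`"), then
[Scholze2015, Thm. V.4.1 / Cor. V.4.2] in the tree's form holds: `GL_n(𝓞_K)` has a torsion-free
subgroup of finite index (Minkowski, `Γ(3)`: the tree's
`NumberFields.GeneralLinearGroup.exists_finiteIndex_forall_isOfFinOrder_eq_one`).  Same hypothesis,
verbatim, as `BorelSerre1973_finite_groupCohomology_congruenceSubgroup_of_typeFL_torsionFree`.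
[cite: Scholze2015, Thm. V.4.1 and Cor. V.4.2] [cite: BorelSerre1973, §11.1 (c), Thm. 11.4.4 (proof), 11.6] -/
theorem algebraicWeightEigenclass_continuousPoint_of_typeFL_torsionFree
    (h : ∀ (n : ℕ) (K : Type) [Field K] [NumberField K] (Γ' : Subgroup (GL (Fin n) (𝓞 K))),
      Γ'.FiniteIndex → (∀ g : Γ', IsOfFinOrder g → g = 1) →
      ∃ P : ProjectiveResolution (Rep.trivial ℤ Γ' ℤ),
        ∀ i, ∃ m : ℕ, Nonempty (P.complex.X i ≅ Rep.free ℤ Γ' (Fin m))) :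
    algebraicWeightEigenclass_continuousPoint :=
  algebraicWeightEigenclass_continuousPoint_of_glIntegers fun n K _ _ => by
    obtain ⟨Γ', hΓ', htf⟩ :=
      NumberFields.GeneralLinearGroup.exists_finiteIndex_forall_isOfFinOrder_eq_one K (n := Fin n)
    exact ⟨Γ', hΓ', h n K Γ' hΓ' htf⟩

end AlgebraicWeight

end Literature.NumberTheory.Automorphic
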